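import Mathlib

/-!
# The unit ball `𝔹^p ⊂ ℂ^p` as a homogeneous space of `U(p,1)`: the model for every `p`

Blind re-derivation cell `pub-hodge-repro`, seat `typer-2` (gen 3).  The sealed `BallModel.lean` (statement (c)) is the case
`p = 2` with indices `Fin 3`.  This file is the same model for EVERY `p`, with the index type `Fin p ⊕ Unit` (the last
coordinate is the `Unit` summand, so block computations are `Matrix.fromBlocks`): `J = diag(1,…,1,−1)`, `U(p,1) = {g ∈ GL :
gᴴ J g = J}`, `𝔹^p = {z : Σ|z_i|² < 1}`, the fractional-linear action `g • z = proj (g (z,1))`, the Jacobian `J_g(z)`, and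
the pull-back of a cotangent field `F : 𝔹^p → ℂ^p` by `γ`: `(γ^*F)(z) = J_γ(z)ᵀ F(γ z)`.  Proved here: the action laws
(`act_one`, `act_mul`, `MulAction`), the **chain rule** `J_{gh}(z) = J_g(hz) · J_h(z)` by a structured argument (the
auxiliary matrix `N g w` with `N g w *ᵥ w = 0`), `Jac_one`, invertibility of every Jacobian.  Purpose: the pointwise core of
ROUTE.md Appendix A4 (Lemma W) for arbitrary `p` and `i`-forms — the general form of sealed (c).  Sources: Rudin, *Function
Theory in the Unit Ball of ℂⁿ*, Thm. 2.2.3 / §2.2; Jacobowitz, *An Introduction to CR Structures*, Ch. 2 §1.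
-/

set_option autoImplicit false

noncomputable section

namespace HodgeRepro.BallGen

open Matrix Complex ComplexConjugate

variable (p : ℕ)

/-- Homogeneous coordinates: `p` affine coordinates and the last one. -/
abbrev Idx : Type := Fin p ⊕ Unit

/-- The last index. -/
abbrev last : Idx p := Sum.inr ()

/-- `J = diag(1, …, 1, −1)`. -/
def J : Matrix (Idx p) (Idx p) ℂ := Matrix.diagonal (Sum.elim (fun _ => 1) (fun _ => -1))

/-- `J` as a block matrix. -/
theorem J_eq_fromBlocks : J p = Matrix.fromBlocks 1 0 0 (-1) := by
  rw [J, ← Matrix.fromBlocks_diagonal, Matrix.diagonal_one]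
  congr 1

/-- `J * J = 1`. -/
theorem J_mul_J : J p * J p = 1 := by
  rw [J, Matrix.diagonal_mul_diagonal]
  ext i j
  rcases i with i | i <;> rcases j with j | j <;> simp [Matrix.diagonal, Matrix.one_apply]

/-- `GL_{p+1}(ℂ)` in homogeneous coordinates. -/
abbrev GLp : Type := GL (Idx p) ℂ

/-- `U(p,1) = {g ∈ GL : gᴴ J g = J}` as a subgroup. -/
def U : Subgroup (GLp p) where
  carrier := {g | (g : Matrix (Idx p) (Idx p) ℂ)ᴴ * J p * (g : Matrix (Idx p) (Idx p) ℂ) = J p}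
  mul_mem' := by
    intro g h hg hh
    simp only [Set.mem_setOf_eq, Units.val_mul, conjTranspose_mul] at hg hh ⊢
    calc (h : Matrix (Idx p) (Idx p) ℂ)ᴴ * (g : Matrix (Idx p) (Idx p) ℂ)ᴴ * J p *
          ((g : Matrix (Idx p) (Idx p) ℂ) * (h : Matrix (Idx p) (Idx p) ℂ))
        = (h : Matrix (Idx p) (Idx p) ℂ)ᴴ * ((g : Matrix (Idx p) (Idx p) ℂ)ᴴ * J p *
          (g : Matrix (Idx p) (Idx p) ℂ)) * (h : Matrix (Idx p) (Idx p) ℂ) := by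
          simp only [Matrix.mul_assoc]
      _ = J p := by rw [hg, hh]
  one_mem' := by simp
  inv_mem' := by
    intro g hg
    simp only [Set.mem_setOf_eq] at hg ⊢
    set gi : Matrix (Idx p) (Idx p) ℂ := ((g⁻¹ : GLp p) : Matrix (Idx p) (Idx p) ℂ) with hgi
    have hmul : (g : Matrix (Idx p) (Idx p) ℂ) * gi = 1 := by
      rw [hgi, ← Units.val_mul, mul_inv_cancel, Units.val_one]
    calc giᴴ * J p * gi = giᴴ * ((g : Matrix (Idx p) (Idx p) ℂ)ᴴ * J p * (g : Matrix (Idx p) (Idx p) ℂ)) * gi := by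
          rw [hg]
      _ = ((g : Matrix (Idx p) (Idx p) ℂ) * gi)ᴴ * J p * ((g : Matrix (Idx p) (Idx p) ℂ) * gi) := by
          simp only [conjTranspose_mul, Matrix.mul_assoc]
      _ = J p := by rw [hmul]; simp

variable {p}

/-- The matrix of an element of `U(p,1)`. -/
abbrev mat (g : U p) : Matrix (Idx p) (Idx p) ℂ := ((g : GLp p) : Matrix (Idx p) (Idx p) ℂ)

/-- The defining relation `gᴴ J g = J`. -/
theorem mat_mem (g : U p) : (mat g)ᴴ * J p * mat g = J p := g.2

/-- `mat` is multiplicative. -/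
theorem mat_mul (g h : U p) : mat (g * h) = mat g * mat h := rfl

/-- `mat 1 = 1`. -/
theorem mat_one : mat (1 : U p) = 1 := rfl

/-- A matrix with `gᴴ J g = J` is invertible, with inverse `J gᴴ J`. -/
theorem JconjJ_mul {g : Matrix (Idx p) (Idx p) ℂ} (h : gᴴ * J p * g = J p) : (J p * gᴴ * J p) * g = 1 := by
  calc (J p * gᴴ * J p) * g = J p * (gᴴ * J p * g) := by simp only [Matrix.mul_assoc]
    _ = 1 := by rw [h, J_mul_J]

/-- Build an element of `U(p,1)` from a matrix satisfying the defining relation. -/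
def mkU (g : Matrix (Idx p) (Idx p) ℂ) (h : gᴴ * J p * g = J p) : U p :=
  ⟨⟨g, J p * gᴴ * J p, mul_eq_one_comm.mp (JconjJ_mul h), JconjJ_mul h⟩, h⟩

/-- The matrix of `mkU g h` is `g`. -/
@[simp] theorem mat_mkU (g : Matrix (Idx p) (Idx p) ℂ) (h : gᴴ * J p * g = J p) : mat (mkU g h) = g := rfl

/-! ### The form, the ball, the lift and the projection -/

/-- The real quadratic form `Q(v) = Σ_{i<p} |v_i|² − |v_last|²` of `J`. -/
def Q (v : Idx p → ℂ) : ℝ := ∑ i : Fin p, ‖v (Sum.inl i)‖ ^ 2 - ‖v (last p)‖ ^ 2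

/-- `v̄ᵀ J v = Q(v)`. -/
theorem form_eq_Q (v : Idx p → ℂ) : star v ⬝ᵥ (J p *ᵥ v) = ((Q v : ℝ) : ℂ) := by
  simp only [J, mulVec_diagonal, dotProduct, Fintype.sum_sum_type, Fintype.sum_unique, Pi.star_apply,
    Complex.star_def, Q, Sum.elim_inl, Sum.elim_inr, last, one_mul, neg_one_mul, mul_neg, Complex.conj_mul']
  push_cast
  ring

/-- A matrix preserving `J` preserves the sesquilinear form. -/
theorem form_invariant {g : Matrix (Idx p) (Idx p) ℂ} (h : gᴴ * J p * g = J p) (v : Idx p → ℂ) :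
    star (g *ᵥ v) ⬝ᵥ (J p *ᵥ (g *ᵥ v)) = star v ⬝ᵥ (J p *ᵥ v) := by
  rw [Matrix.star_mulVec, Matrix.mulVec_mulVec, Matrix.dotProduct_mulVec, Matrix.vecMul_vecMul,
    ← Matrix.mul_assoc, h, ← Matrix.dotProduct_mulVec]

/-- `Q(g v) = Q(v)` for `g` preserving `J`. -/
theorem Q_mulVec {g : Matrix (Idx p) (Idx p) ℂ} (h : gᴴ * J p * g = J p) (v : Idx p → ℂ) : Q (g *ᵥ v) = Q v := by
  have := form_invariant h v
  rw [form_eq_Q, form_eq_Q] at this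
  exact_mod_cast this

/-- `Σ |z_i|²`. -/
def nsq (z : Fin p → ℂ) : ℝ := ∑ i, ‖z i‖ ^ 2

/-- The complex `p`-ball `𝔹^p = {z ∈ ℂ^p : Σ|z_i|² < 1}` (a type). -/
def Ball (p : ℕ) : Type := {z : Fin p → ℂ // nsq z < 1}

/-- The subspace topology of `𝔹^p ⊂ ℂ^p`. -/
instance : TopologicalSpace (Ball p) := instTopologicalSpaceSubtype

/-- The lift `z ↦ (z, 1)` (homogeneous coordinates with last coordinate `1`). -/
def lift (z : Ball p) : Idx p → ℂ := Sum.elim z.1 fun _ => 1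

/-- `lift z (inl i) = z i`. -/
@[simp] theorem lift_inl (z : Ball p) (i : Fin p) : lift z (Sum.inl i) = z.1 i := rfl

/-- `lift z last = 1`. -/
@[simp] theorem lift_last (z : Ball p) : lift z (last p) = 1 := rfl

/-- The lift of a point of the ball is `J`-negative. -/
theorem Q_lift (z : Ball p) : Q (lift z) < 0 := by
  have := z.2
  simp only [Q, lift, nsq, Sum.elim_inl, Sum.elim_inr, norm_one, one_pow, last] at this ⊢
  linarith

/-- For a `J`-negative vector the last coordinate does not vanish. -/
theorem ne_zero_of_Q_neg {w : Idx p → ℂ} (hw : Q w < 0) : w (last p) ≠ 0 := by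
  intro h
  simp only [Q, h, norm_zero] at hw
  have : 0 ≤ ∑ i : Fin p, ‖w (Sum.inl i)‖ ^ 2 := Finset.sum_nonneg fun i _ => by positivity
  linarith

/-- Projection of a `J`-negative vector to the ball: `w ↦ (w_i / w_last)_i`. -/
def proj (w : Idx p → ℂ) (hw : Q w < 0) : Ball p :=
  ⟨fun i => w (Sum.inl i) / w (last p), by
    have h2 := ne_zero_of_Q_neg hw
    have hpos : 0 < ‖w (last p)‖ ^ 2 := by positivity
    simp only [nsq, norm_div, div_pow]
    rw [← Finset.sum_div, div_lt_one hpos]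
    simp only [Q] at hw; linarith⟩

/-- `(proj w) i = w i / w last`. -/
@[simp] theorem proj_apply (w : Idx p → ℂ) (hw : Q w < 0) (i : Fin p) : (proj w hw).1 i = w (Sum.inl i) / w (last p) := rfl

/-- `proj` only depends on the vector. -/
theorem proj_congr {w w' : Idx p → ℂ} (h : w = w') (hw : Q w < 0) (hw' : Q w' < 0) : proj w hw = proj w' hw' := by
  subst h; rfl

/-- `proj` is invariant under nonzero rescaling. -/
theorem proj_smul (w : Idx p → ℂ) (hw : Q w < 0) (μ : ℂ) (hμ : μ ≠ 0) (hw' : Q (μ • w) < 0) :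
    proj (μ • w) hw' = proj w hw := by
  apply Subtype.ext
  ext i
  simp [proj, mul_div_mul_left _ _ hμ]

/-- The lift of `proj w` is `w / w_last`. -/
theorem lift_proj (w : Idx p → ℂ) (hw : Q w < 0) : lift (proj w hw) = (w (last p))⁻¹ • w := by
  have h2 := ne_zero_of_Q_neg hw
  ext i
  rcases i with i | i
  · simp [lift, proj, div_eq_inv_mul]
  · simp [lift, last, h2]

/-! ### The action and the Jacobian -/

/-- The image `g · (z, 1)` of the lift. -/
def W (g : U p) (z : Ball p) : Idx p → ℂ := mat g *ᵥ lift z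

/-- `g · (z, 1)` is `J`-negative. -/
theorem Q_W (g : U p) (z : Ball p) : Q (W g z) < 0 := by
  unfold W; rw [Q_mulVec (mat_mem g)]; exact Q_lift z

/-- The denominator `(g · (z,1))_last` of the action never vanishes on the ball. -/
theorem W_last_ne_zero (g : U p) (z : Ball p) : W g z (last p) ≠ 0 := ne_zero_of_Q_neg (Q_W g z)

/-- The action `act g z := proj (g · lift z)`: the fractional-linear map `z ↦ ((g(z,1))_i / (g(z,1))_last)_i`. -/
def act (g : U p) (z : Ball p) : Ball p := proj (W g z) (Q_W g z)

/-- Jacobian matrix of `z ↦ act g z` at `z`: with `w = g·(z,1)`, `∂(w_i/w_last)/∂z_j = (g_{ij} w_last − w_i g_{last,j}) / w_last²`. -/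
def Jac (g : U p) (z : Ball p) : Matrix (Fin p) (Fin p) ℂ :=
  Matrix.of fun i j => (mat g (Sum.inl i) (Sum.inl j) * W g z (last p) -
    W g z (Sum.inl i) * mat g (last p) (Sum.inl j)) / W g z (last p) ^ 2

/-- The pull-back (translate) of a cotangent field `F : 𝔹^p → ℂ^p` by `γ`: `(γ^*F)(z) = J_γ(z)ᵀ F(γ z)`. -/
def pullback (γ : U p) (F : Ball p → Fin p → ℂ) (z : Ball p) : Fin p → ℂ := (Jac γ z)ᵀ *ᵥ F (act γ z)

/-! ### `act` is a group action -/

/-- `(gh)·(z,1) = g·(h·(z,1))`. -/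
theorem W_mul (g h : U p) (z : Ball p) : W (g * h) z = mat g *ᵥ W h z := by
  unfold W; rw [mat_mul, Matrix.mulVec_mulVec]

/-- `1·(z,1) = (z,1)`. -/
theorem W_one (z : Ball p) : W 1 z = lift z := by
  unfold W; rw [mat_one, Matrix.one_mulVec]

/-- `g · lift (h z) = (h·(z,1))_last⁻¹ · (gh)·(z,1)`. -/
theorem W_act (g h : U p) (z : Ball p) : W g (act h z) = (W h z (last p))⁻¹ • W (g * h) z := by
  change mat g *ᵥ lift (proj (W h z) (Q_W h z)) = _
  rw [lift_proj, Matrix.mulVec_smul, W_mul]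

/-- `act` is compatible with multiplication: `g (h z) = (gh) z`. -/
theorem act_mul (g h : U p) (z : Ball p) : act g (act h z) = act (g * h) z := by
  have hQ : Q ((W h z (last p))⁻¹ • W (g * h) z) < 0 := by rw [← W_act]; exact Q_W g (act h z)
  calc act g (act h z) = proj (W g (act h z)) (Q_W g (act h z)) := rfl
    _ = proj ((W h z (last p))⁻¹ • W (g * h) z) hQ := proj_congr (W_act g h z) _ _
    _ = proj (W (g * h) z) (Q_W (g * h) z) := proj_smul _ _ _ (inv_ne_zero (W_last_ne_zero h z)) _
    _ = act (g * h) z := rfl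

/-- The identity acts trivially. -/
theorem act_one (z : Ball p) : act 1 z = z := by
  have hQ : Q (lift z) < 0 := Q_lift z
  calc act 1 z = proj (W 1 z) (Q_W 1 z) := rfl
    _ = proj (lift z) hQ := proj_congr (W_one z) _ _
    _ = z := by
        apply Subtype.ext
        ext i
        simp [proj, lift]

/-- `U(p,1)` acts on the ball. -/
instance : MulAction (U p) (Ball p) where
  smul := act
  one_smul := act_one
  mul_smul g h z := (act_mul g h z).symm

/-- `g • z = act g z`. -/
theorem smul_def (g : U p) (z : Ball p) : g • z = act g z := rfl

/-- `g⁻¹ (g z) = z`. -/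
theorem act_inv_act (g : U p) (z : Ball p) : act g⁻¹ (act g z) = z := by
  rw [← smul_def, ← smul_def, inv_smul_smul]

/-- `g (g⁻¹ z) = z`. -/
theorem act_act_inv (g : U p) (z : Ball p) : act g (act g⁻¹ z) = z := by
  rw [← smul_def, ← smul_def, smul_inv_smul]

/-! ### The chain rule -/

/-- The auxiliary `p × (p+1)` matrix `N_{im} = (g_{im} w'_last − w'_i g_{last,m}) / w'_last²`, `w' = g w`. -/
def N (g : U p) (w : Idx p → ℂ) : Matrix (Fin p) (Idx p) ℂ :=
  Matrix.of fun i m => (mat g (Sum.inl i) m * (mat g *ᵥ w) (last p) - (mat g *ᵥ w) (Sum.inl i) * mat g (last p) m) /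
    (mat g *ᵥ w) (last p) ^ 2

/-- The key identity `N g w *ᵥ w = 0`. -/
theorem N_mulVec (g : U p) (w : Idx p → ℂ) : N g w *ᵥ w = 0 := by
  ext i
  simp only [N, Matrix.mulVec, dotProduct, Matrix.of_apply, Pi.zero_apply]
  set S := ∑ x, mat g (last p) x * w x with hS
  set T := ∑ x, mat g (Sum.inl i) x * w x with hT
  have e : ∀ x, (mat g (Sum.inl i) x * S - T * mat g (last p) x) / S ^ 2 * w x =
      (S * (mat g (Sum.inl i) x * w x) - T * (mat g (last p) x * w x)) / S ^ 2 := fun x => by ring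
  simp only [e, ← Finset.sum_div, Finset.sum_sub_distrib, ← Finset.mul_sum]
  rw [← hS, ← hT, mul_comm S T, sub_self, zero_div]

/-- `J_{gh}(z) = N g (h·(z,1)) · (h restricted to the first `p` columns)`. -/
theorem Jac_mul_eq_N (g h : U p) (z : Ball p) :
    Jac (g * h) z = N g (W h z) * (mat h).submatrix id Sum.inl := by
  ext i j
  simp only [Jac, N, Matrix.of_apply, Matrix.mul_apply, Matrix.submatrix_apply, id, W_mul, mat_mul]
  set w' := mat g *ᵥ W h z with hw'
  have e : ∀ x, (mat g (Sum.inl i) x * w' (last p) - w' (Sum.inl i) * mat g (last p) x) / w' (last p) ^ 2 *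
      mat h x (Sum.inl j) =
      (w' (last p) * (mat g (Sum.inl i) x * mat h x (Sum.inl j)) -
        w' (Sum.inl i) * (mat g (last p) x * mat h x (Sum.inl j))) / w' (last p) ^ 2 := fun x => by ring
  simp only [e, ← Finset.sum_div, Finset.sum_sub_distrib, ← Finset.mul_sum]
  ring

/-- `J_g(hz) = w_last · (N g w restricted to the first `p` columns)`, `w = h·(z,1)`. -/
theorem Jac_act_eq_N (g h : U p) (z : Ball p) :
    Jac g (act h z) = W h z (last p) • (N g (W h z)).submatrix id Sum.inl := by
  have hμ : W h z (last p) ≠ 0 := W_last_ne_zero h z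
  have hW : W g (act h z) = (W h z (last p))⁻¹ • (mat g *ᵥ W h z) := by rw [W_act, W_mul]
  have hw' : (mat g *ᵥ W h z) (last p) ≠ 0 := by
    have := W_last_ne_zero (g * h) z; rwa [W_mul] at this
  ext i j
  simp only [Jac, N, Matrix.of_apply, Matrix.smul_apply, Matrix.submatrix_apply, id, hW, Pi.smul_apply, smul_eq_mul]
  field_simp

/-- **Chain rule**: `J_{gh}(z) = J_g(hz) · J_h(z)`. -/
theorem Jac_mul (g h : U p) (z : Ball p) : Jac (g * h) z = Jac g (act h z) * Jac h z := by
  have hμ : W h z (last p) ≠ 0 := W_last_ne_zero h z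
  have hN := N_mulVec g (W h z)
  rw [Jac_mul_eq_N, Jac_act_eq_N, Matrix.smul_mul]
  ext i j
  simp only [Matrix.mul_apply, Matrix.submatrix_apply, id, Matrix.smul_apply, smul_eq_mul, Jac,
    Matrix.of_apply, Fintype.sum_sum_type, Fintype.sum_unique]
  have key : ∑ m : Fin p, N g (W h z) i (Sum.inl m) * W h z (Sum.inl m) + N g (W h z) i (last p) * W h z (last p) = 0 := by
    have := congr_fun hN i
    simpa [Matrix.mulVec, dotProduct, Fintype.sum_sum_type, Fintype.sum_unique] using this
  rw [Finset.mul_sum]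
  have e : ∀ m : Fin p, W h z (last p) * (N g (W h z) i (Sum.inl m) *
      ((mat h (Sum.inl m) (Sum.inl j) * W h z (last p) - W h z (Sum.inl m) * mat h (last p) (Sum.inl j)) /
        W h z (last p) ^ 2)) =
      N g (W h z) i (Sum.inl m) * mat h (Sum.inl m) (Sum.inl j) -
        (mat h (last p) (Sum.inl j) / W h z (last p)) * (N g (W h z) i (Sum.inl m) * W h z (Sum.inl m)) := by
    intro m; field_simp
  simp only [e, Finset.sum_sub_distrib, ← Finset.mul_sum]
  have hs : ∑ m : Fin p, N g (W h z) i (Sum.inl m) * W h z (Sum.inl m) = -(N g (W h z) i (last p) * W h z (last p)) := by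
    linear_combination key
  rw [hs]
  field_simp
  ring

/-- The Jacobian of the identity is the identity matrix. -/
theorem Jac_one (z : Ball p) : Jac 1 z = 1 := by
  ext i j
  simp only [Jac, W_one, mat_one, Matrix.of_apply, lift_last, Matrix.one_apply]
  by_cases h : i = j
  · subst h; simp
  · simp [h, Sum.inl_injective.ne h]

/-- `J_{g⁻¹}(gz) · J_g(z) = 1`. -/
theorem Jac_inv_mul (g : U p) (z : Ball p) : Jac g⁻¹ (act g z) * Jac g z = 1 := by
  rw [← Jac_mul, inv_mul_cancel, Jac_one]

/-- `J_g(z) · J_{g⁻¹}(gz) = 1`. -/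
theorem Jac_mul_inv (g : U p) (z : Ball p) : Jac g z * Jac g⁻¹ (act g z) = 1 :=
  mul_eq_one_comm.mp (Jac_inv_mul g z)

/-- Every Jacobian `J_g(z)` is invertible. -/
theorem isUnit_Jac (g : U p) (z : Ball p) : IsUnit (Jac g z) :=
  IsUnit.of_mul_eq_one_right _ (Jac_inv_mul g z)

/-- `det J_g(z) ≠ 0`. -/
theorem det_Jac_ne_zero (g : U p) (z : Ball p) : (Jac g z).det ≠ 0 :=
  ((Matrix.isUnit_iff_isUnit_det _).mp (isUnit_Jac g z)).ne_zero

/-- The transpose of a Jacobian is injective on covectors. -/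
theorem Jac_transpose_mulVec_injective (g : U p) (z : Ball p) :
    Function.Injective fun u : Fin p → ℂ => (Jac g z)ᵀ *ᵥ u := by
  intro u v huv
  have h := Jac_mul_inv g z
  have h' : (Jac g⁻¹ (act g z))ᵀ * (Jac g z)ᵀ = 1 := by rw [← Matrix.transpose_mul, h, Matrix.transpose_one]
  have := congrArg (fun x => (Jac g⁻¹ (act g z))ᵀ *ᵥ x) huv
  simpa [Matrix.mulVec_mulVec, h'] using this

/-- Pull-back along a product: `(gh)^*F = h^*(g^*F)`. -/
theorem pullback_mul (g h : U p) (F : Ball p → Fin p → ℂ) (z : Ball p) :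
    pullback (g * h) F z = pullback h (pullback g F) z := by
  simp only [pullback, Jac_mul, Matrix.transpose_mul, ← Matrix.mulVec_mulVec, act_mul]

end HodgeRepro.BallGen

end
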